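import Summits.Parity.GeneralizedHardyLittlewood.Theorems.ZDegreeToeplitzBandLemma81ExtCell
import Literature.NumberTheory.LFunctions.Zhang2022.Section8Ded81Bridge

/-!
# Route `ZDegreeToeplitzBand`, crux `PsiGradedTablesClosePoly` (stmt-Parity-22438), line `long_poly_dil`, stub
# `stub_lemma81LongPsiDil` (P2-Dil): Part 8 — ANCHOR: the generic two-truncation chain reproduces the PRINTED Lemma 8.1
# (`Skeleton.Lemma81`) at `N₁ = N₂ = Nsupp`, `X = C·P²𝓛³⁶` — the one-log budget, kernel-checked end to end

Y. Zhang, *Discrete mean estimates and the Landau–Siegel zero*, arXiv:2211.02515v1 — an unrefereed manuscript under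
adjudication. **The programme SEARCHES and TYPES; no claim about Landau–Siegel zeros, Theorems 1–2 of arXiv:2211.02515
or a repaired Margin232 until a kernel theorem says so.**

`lemma81_eventually_via_ext`: `∃ c₀ ∀ c′ ≥ c₀, Skeleton.Lemma81 c′`, re-proved THROUGH `lemma81Ext_of_meanSquare_eventually`
(Parts 1–5) with the tree's Z22:§8.u014 `Ded81Edge.step8u014_body` as the mean-square input `X = C₄·P²·𝓛³⁶`
(`lhs81 = lhs81Ext Nsupp Nsupp`, `Theta1 = Theta1Ext Nsupp Nsupp` definitionally): the error
`C·𝓛⁻⁹⁶·P·√(C₄P²𝓛³⁶) + 1 = C√C₄·P²𝓛⁻⁷⁸ + 1` is `≤ ε𝔓` by `Ded81Edge.exists_large_main_le` — EXACTLY the printed one-log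
budget (`𝔓 ≍ P²𝓛⁻⁷⁷`). The tree already has `Skeleton.lemma81_eventually`; this file is a consistency anchor for the
generic chain (its constants and exponents are the printed ones), not a new fact. Theorems only. Prover: ls-knife-typer-3
g20 (cell landau-siegel §D), `--supports` stmt-Parity-22438. [cite: Zhang2022LandauSiegel, §8 Lemma 8.1 pp. 42–44]
-/

noncomputable section

open Complex Real Set ComplexConjugate
open Literature.NumberTheory.LFunctions.Zhang2022
open Literature.NumberTheory.LFunctions.Zhang2022.Skeleton
open Literature.NumberTheory.LFunctions.Zhang2022.Section8aStatements
open Literature.NumberTheory.LFunctions.Zhang2022.KnifeEdge.LongLegSplit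

namespace Summit.Parity.GeneralizedHardyLittlewood.Theorems

/-- **ANCHOR: the printed Lemma 8.1 for every large `c′`, via the generic two-truncation chain.** At
`N₁ = N₂ = ⌈PT⁻²⌉` and (7.2)-data (`|a| ≤ B ≤ P¹⁰`, `Nsupp ≤ P³`), with `X := C₄P²𝓛³⁶` from the tree's u014
(`Ded81Edge.step8u014_body`, for the pair and — by `adm72_conj` — for its reflection), `lemma81Ext_of_meanSquare_eventually`
gives `‖lhs81 − (Θ₁ + conj Θ₁′)‖ ≤ C√C₄·P²𝓛⁻⁷⁸ + 1 ≤ ε𝔓` (`exists_large_main_le`, `𝔓 → ∞`).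
[cite: Zhang2022LandauSiegel, §8 Lemma 8.1 pp. 42–44; §2 (2.9)] -/
theorem lemma81_eventually_via_ext : ∃ c₀ : ℝ, ∀ c' : ℝ, c₀ ≤ c' → Skeleton.Lemma81 c' := by
  obtain ⟨c₀, -, hgen⟩ := lemma81Ext_of_meanSquare_eventually
  refine ⟨c₀, fun c' hc' => ?_⟩
  intro B ε hε
  obtain ⟨C, Dg, hg⟩ := hgen c' hc'
  obtain ⟨C₄, D₄, h14⟩ := Ded81Edge.step8u014_body B
  have hC₄ : 0 ≤ max C₄ 0 := le_max_right _ _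
  obtain ⟨D₁, hD₁⟩ := Ded81Edge.exists_large_main_le (|C| * Real.sqrt (max C₄ 0)) (ε / 2) (by linarith)
  obtain ⟨D₂, hD₂⟩ := Skeleton.exists_nat_forall_le_ell (|B| + 28)
  obtain ⟨D₃, hD₃⟩ := lemma81Dil_exists_le_frakP (2 / ε)
  refine ⟨max (max Dg D₄) (max (max D₁ D₂) (max D₃ 1)), ?_⟩
  intro D _ χ hD hq hp hA a₁ a₂ ha₁ ha₂
  have hDg : Dg ≤ D := le_trans (le_trans (le_max_left _ _) (le_max_left _ _)) hD
  have hD4 : D₄ ≤ D := le_trans (le_trans (le_max_right _ _) (le_max_left _ _)) hD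
  have hD1 := hD₁ D (le_trans (le_trans (le_trans (le_max_left _ _) (le_max_left _ _)) (le_max_right _ _)) hD)
  have hℓ := hD₂ D (le_trans (le_trans (le_trans (le_max_right _ _) (le_max_left _ _)) (le_max_right _ _)) hD)
  have h𝔓 := hD₃ D (le_trans (le_trans (le_trans (le_max_left _ _) (le_max_right _ _)) (le_max_right _ _)) hD)
  have hD1' : 1 ≤ D := le_trans (le_trans (le_trans (le_max_right _ _) (le_max_right _ _)) (le_max_right _ _)) hD
  have hℓ1 : 1 ≤ ell D := by linarith [abs_nonneg B]
  have h14D := h14 D χ hD4 hq hp hA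
  -- sizes: `Nsupp ≤ P³`, `B ≤ P¹⁰`
  obtain ⟨-, hN2, -, -⟩ := lemma81Dil_sizes (B := B) hD1' hℓ
  have hP1 : 1 ≤ bigP D := by rw [bigP]; exact Real.one_le_exp (by positivity)
  have hBP : B ≤ bigP D ^ 10 := by
    calc B ≤ |B| + 28 := by linarith [le_abs_self B]
      _ ≤ ell D := hℓ
      _ ≤ ell D ^ 9 := le_self_pow₀ hℓ1 (by norm_num)
      _ ≤ Real.exp (ell D ^ 9) := by linarith [Real.add_one_le_exp (ell D ^ 9)]
      _ = bigP D ^ 1 := by rw [bigP, pow_one]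
      _ ≤ bigP D ^ 10 := pow_le_pow_right₀ hP1 (by norm_num)
  have ha₁' : ∀ n, n < Nsupp D → ‖a₁ n‖ ≤ bigP D ^ 10 := fun n _ => (ha₁.1 n).trans hBP
  have ha₂' : ∀ n, n < Nsupp D → ‖a₂ n‖ ≤ bigP D ^ 10 := fun n _ => (ha₂.1 n).trans hBP
  -- the mean squares from the tree's u014 (the reflected pair via `adm72_conj`)
  have hmem : ∀ v ∈ Icc (-ell1 D) (ell1 D),
      ∃ w : ℝ, |w| ≤ ell1 D ∧ ((alpha D : ℝ) : ℂ) + s0 D + v * I = ((alpha D : ℝ) : ℂ) + s0 D + w * I :=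
    fun v hv => ⟨v, abs_le.mpr ⟨by linarith [hv.1], hv.2⟩, rfl⟩
  have hX0 : 0 ≤ bigP D ^ 2 * ell D ^ 36 := by positivity
  have hXA : ∀ v ∈ Icc (-ell1 D) (ell1 D), ∑ x ∈ finsetOf (PsiOne χ),
      ‖Lemma81.dirPoly (Nsupp D) a₁ x.ψ (((alpha D : ℝ) : ℂ) + s0 D + v * I) *
          Lemma81.dirPoly (Nsupp D) a₂ x.ψ⁻¹ (1 - (((alpha D : ℝ) : ℂ) + s0 D + v * I))‖ ^ 2 ≤
        max C₄ 0 * bigP D ^ 2 * ell D ^ 36 := fun v hv =>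
    (h14D a₁ a₂ ha₁ ha₂ _ (hmem v hv)).trans (by gcongr; exact le_max_left _ _)
  have hXB : ∀ v ∈ Icc (-ell1 D) (ell1 D), ∑ x ∈ finsetOf (PsiOne χ),
      ‖Lemma81.dirPoly (Nsupp D) (fun n => conj (a₂ n)) x.ψ (((alpha D : ℝ) : ℂ) + s0 D + v * I) *
          Lemma81.dirPoly (Nsupp D) (fun n => conj (a₁ n)) x.ψ⁻¹ (1 - (((alpha D : ℝ) : ℂ) + s0 D + v * I))‖ ^ 2 ≤
        max C₄ 0 * bigP D ^ 2 * ell D ^ 36 := fun v hv =>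
    (h14D _ _ (Ded81Edge.adm72_conj ha₂) (Ded81Edge.adm72_conj ha₁) _ (hmem v hv)).trans
      (by gcongr; exact le_max_left _ _)
  have key := hg D χ hDg hq hp hA (Nsupp D) (Nsupp D) a₁ a₂ (max C₄ 0 * bigP D ^ 2 * ell D ^ 36)
    hN2 hN2 ha₁' ha₂' hXA hXB
  -- `lhs81 = lhs81Ext Nsupp Nsupp`, `Theta1 = Theta1Ext Nsupp Nsupp`
  rw [← lhs81Ext_nsupp, ← Theta1Ext_nsupp, ← Theta1Ext_nsupp]
  refine key.trans ?_
  -- the printed budget: `C𝓛⁻⁹⁶P·√(C₄P²𝓛³⁶) = C√C₄·P²𝓛³⁶𝓛⁻¹¹⁴ ≤ (ε/2)𝔓`, `1 ≤ (ε/2)𝔓`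
  have h1 : C * ((ell D ^ 96)⁻¹ * bigP D) * Real.sqrt (max C₄ 0 * bigP D ^ 2 * ell D ^ 36) ≤ ε / 2 * frakP D := by
    have e : C * ((ell D ^ 96)⁻¹ * bigP D) * Real.sqrt (max C₄ 0 * bigP D ^ 2 * ell D ^ 36) =
        C * Real.sqrt (max C₄ 0) * (bigP D ^ 2 * ell D ^ 36 * (ell D ^ 114)⁻¹) := by
      have h := lemma81Ext_sqrt_budget hC₄ hℓ1
      have hℓ0 : ell D ≠ 0 := by linarith
      calc C * ((ell D ^ 96)⁻¹ * bigP D) * Real.sqrt (max C₄ 0 * bigP D ^ 2 * ell D ^ 36)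
          = C * bigP D * ((ell D ^ 114) * ((ell D ^ 114)⁻¹ * Real.sqrt (max C₄ 0 * bigP D ^ 2 * ell D ^ 36)))
              * (ell D ^ 96)⁻¹ := by field_simp
        _ = C * bigP D * ((ell D ^ 114) * (Real.sqrt (max C₄ 0) * ((ell D ^ 96)⁻¹ * bigP D))) * (ell D ^ 96)⁻¹ := by
              rw [h]
        _ = C * Real.sqrt (max C₄ 0) * (bigP D ^ 2 * ell D ^ 36 * (ell D ^ 114)⁻¹) := by field_simp
    rw [e]
    calc C * Real.sqrt (max C₄ 0) * (bigP D ^ 2 * ell D ^ 36 * (ell D ^ 114)⁻¹)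
        ≤ |C| * Real.sqrt (max C₄ 0) * (bigP D ^ 2 * ell D ^ 36 * (ell D ^ 114)⁻¹) := by
          gcongr; exact le_abs_self C
      _ ≤ ε / 2 * frakP D := hD1
  have h2 : (1 : ℝ) ≤ ε / 2 * frakP D := by
    have e : (1 : ℝ) = ε / 2 * (2 / ε) := by field_simp
    rw [e]; exact mul_le_mul_of_nonneg_left h𝔓 (by positivity)
  linarith

end Summit.Parity.GeneralizedHardyLittlewood.Theorems

end
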